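import Summits.CriticalPhenomena.SAWScalingLimit.Theses.SAWLoopFugacityFlow
import Literature.Probability.LatticeModels.DiluteLoopModelIsing
import Literature.Probability.LatticeModels.DiluteLoopModelSAW
import Literature.Probability.LatticeModels.GKSInequalities
import Literature.Probability.RandomPlanarGeometry.SAWScalingLimitFamily

/-!
# Negative-side results for the crux `SAWLoopFugacityFlow.IsingBoundaryRatio` (stmt-CriticalPhenomena-10650):
LATTICE SIDE — normal form of the crux (the inline two-point function is the library one), idle
hypotheses (the marked-point equalities follow from the two endpoint approximations), the junk
catalogue of the inline free-boundary two-point function (`δ ≤ 0`, coincident endpoints), STRICT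
POSITIVITY of `⟨σ_xσ_y⟩^free_{Ω_δ,β_c}` between joined sites (high-temperature expansion + path
witness), the GKS sandwich `⟨σσ⟩_{Ω'_δ} ≤ ⟨σσ⟩_{Ω_δ}` for nested mesh domains, EVENTUAL NESTING of
the mesh domains under the crux hypotheses, and the consequences: the crux ratio is eventually in
`(0,1]`, every limit is `≤ 1`, the negative-exponent and two-sided variants are false
(work-file §0–§3, §6).

Refuter `cdisprove` (standing adversary); the full indexed work file is
`Summits/CriticalPhenomena/SAWScalingLimit/Cruxes/IsingBoundaryRatio/Disproof.lean`.
-/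

noncomputable section

open scoped Classical symmDiff
open MeasureTheory Filter Topology Set Function
open Literature.Probability.LatticeModels Literature.Probability.RandomPlanarGeometry
open UpperHalfPlane (upperHalfPlaneSet)

namespace Summit.CriticalPhenomena.SAWScalingLimit.Theorems.IsingBoundaryRatio.Negative

open Summit.CriticalPhenomena.SAWScalingLimit.Theses.SAWLoopFugacityFlow (IsingBoundaryRatio)

/-! ## §0 Read-back and normal form -/

/-- The free critical Ising two-point function of `Ω_δ`, library form:
`T Ω δ x y = ⟨σ_x σ_y⟩^free_{Ω_δ; β_c(2), 0}` on `discreteDomainGraph Ω δ`, volume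
`meshDomainFinset Ω δ`. -/
def T (Ω : Set ℂ) (δ : ℝ) (x y : Site 2) : ℝ :=
  isingTwoPoint (discreteDomainGraph Ω δ) (meshDomainFinset Ω δ) criticalBetaTwo 0 .free x y

/-- The INLINE two-point function of the crux (arbitrary `LocallyFinite` structure `lf`, inline
volume, inline `β`) is the library one. [folklore] -/
theorem inline_eq_T (lf : ∀ (Ω : Set ℂ) (δ : ℝ), (discreteDomainGraph Ω δ).LocallyFinite)
    (Ω : Set ℂ) (δ : ℝ) (x y : Site 2) :
    @isingTwoPoint _ (discreteDomainGraph Ω δ) _ (lf Ω δ)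
        (if h : Bornology.IsBounded Ω ∧ 0 < δ then (meshDomain_finite h.1 h.2).toFinset else ∅)
        (Real.log (1 + Real.sqrt 2) / 2) 0 BoundaryCondition.free x y = T Ω δ x y := by
  have hlf : lf Ω δ = instLocallyFiniteDiscreteDomainGraph Ω δ := Subsingleton.elim _ _
  rw [hlf]
  unfold T meshDomainFinset criticalBetaTwo
  congr 1

/-- The crux's ratio `⟨σσ⟩_{Ω'_δ} / ⟨σσ⟩_{Ω_δ}` (real division, `x / 0 = 0`). -/
def ratio (D D' : DobrushinDomain) (a b : ℝ → Site 2) (δ : ℝ) : ℝ :=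
  T D'.carrier δ (a δ) (b δ) / T D.carrier δ (a δ) (b δ)

/-- NORMAL FORM of the crux: library two-point function, no `lf`. -/
def NormalForm : Prop :=
  ∀ (D D' : DobrushinDomain) (a b : ℝ → Site 2), SAW.IsEndpointApprox D a b →
    SAW.IsEndpointApprox D' a b → D'.carrier ⊆ D.carrier → D'.pt 0 = D.pt 0 → D'.pt 1 = D.pt 1 →
    (∃ ε : ℝ, 0 < ε ∧ D'.carrier ∩ Metric.ball (D.pt 0) ε = D.carrier ∩ Metric.ball (D.pt 0) ε ∧
      D'.carrier ∩ Metric.ball (D.pt 1) ε = D.carrier ∩ Metric.ball (D.pt 1) ε) →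
    ∀ (φ : ConformalEquiv upperHalfPlaneSet D.carrier), D.IsChordalUniformizing φ →
    ∀ (A : Set ℂ), A = closure (upperHalfPlaneSet \ {z | z ∈ upperHalfPlaneSet ∧ φ z ∈ D'.carrier}) →
    ∀ (Φ : ConformalEquiv (upperHalfPlaneSet \ A) upperHalfPlaneSet) (d : ℝ),
    IsRestrictionMap A Φ → HasRestrictionDeriv A Φ d →
    Tendsto (ratio D D' a b) (𝓝[>] 0) (𝓝 (d ^ ((1 : ℝ) / 2)))

/-- **The crux is its normal form.** [folklore] -/
theorem isingBoundaryRatio_iff_normalForm : IsingBoundaryRatio ↔ NormalForm := by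
  constructor
  · intro h D D' a b hD hD' hsub h0 h1 hε φ hφ A hA Φ d hΦ hd
    have := h (fun Ω δ => instLocallyFiniteDiscreteDomainGraph Ω δ) D D' a b hD hD' hsub h0 h1 hε
      φ hφ A hA Φ d hΦ hd
    simp only [inline_eq_T] at this
    exact this
  · intro h lf D D' a b hD hD' hsub h0 h1 hε φ hφ A hA Φ d hΦ hd
    simp only [inline_eq_T]
    exact h D D' a b hD hD' hsub h0 h1 hε φ hφ A hA Φ d hΦ hd

/-! ## §1 Idle hypotheses: the marked points agree automatically -/

/-- The two endpoint approximations force `D'.pt i = D.pt i` (uniqueness of limits along the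
non-trivial filter `𝓝[>] 0`). [folklore] -/
theorem pt_eq_of_isEndpointApprox {D D' : DobrushinDomain} {a b : ℝ → Site 2}
    (h : SAW.IsEndpointApprox D a b) (h' : SAW.IsEndpointApprox D' a b) :
    D'.pt 0 = D.pt 0 ∧ D'.pt 1 = D.pt 1 :=
  ⟨tendsto_nhds_unique h'.tendsto_fst h.tendsto_fst, tendsto_nhds_unique h'.tendsto_snd h.tendsto_snd⟩

/-- The crux with the two hypotheses `D'.pt 0 = D.pt 0`, `D'.pt 1 = D.pt 1` deleted. -/
def WithoutPtEq : Prop :=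
  ∀ (D D' : DobrushinDomain) (a b : ℝ → Site 2), SAW.IsEndpointApprox D a b →
    SAW.IsEndpointApprox D' a b → D'.carrier ⊆ D.carrier →
    (∃ ε : ℝ, 0 < ε ∧ D'.carrier ∩ Metric.ball (D.pt 0) ε = D.carrier ∩ Metric.ball (D.pt 0) ε ∧
      D'.carrier ∩ Metric.ball (D.pt 1) ε = D.carrier ∩ Metric.ball (D.pt 1) ε) →
    ∀ (φ : ConformalEquiv upperHalfPlaneSet D.carrier), D.IsChordalUniformizing φ →
    ∀ (A : Set ℂ), A = closure (upperHalfPlaneSet \ {z | z ∈ upperHalfPlaneSet ∧ φ z ∈ D'.carrier}) →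
    ∀ (Φ : ConformalEquiv (upperHalfPlaneSet \ A) upperHalfPlaneSet) (d : ℝ),
    IsRestrictionMap A Φ → HasRestrictionDeriv A Φ d →
    Tendsto (ratio D D' a b) (𝓝[>] 0) (𝓝 (d ^ ((1 : ℝ) / 2)))

/-- Deleting the marked-point equalities does NOT change the crux (they are idle). [folklore] -/
theorem normalForm_iff_withoutPtEq : NormalForm ↔ WithoutPtEq := by
  constructor
  · intro h D D' a b hD hD' hsub hε φ hφ A hA Φ d hΦ hd
    obtain ⟨h0, h1⟩ := pt_eq_of_isEndpointApprox hD hD'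
    exact h D D' a b hD hD' hsub h0 h1 hε φ hφ A hA Φ d hΦ hd
  · intro h D D' a b hD hD' hsub _ _ hε φ hφ A hA Φ d hΦ hd
    exact h D D' a b hD hD' hsub hε φ hφ A hA Φ d hΦ hd

/-! ## §2 Junk values of the inline two-point function -/

/-- Diagonal sites: `T Ω δ x x = 1` (so the ratio is `1` whenever `a δ = b δ`). [folklore] -/
@[simp] theorem T_self (Ω : Set ℂ) (δ : ℝ) (x : Site 2) : T Ω δ x x = 1 :=
  isingTwoPoint_self _ _ _ _ _ x

/-- Free-boundary junk: two sites OUTSIDE the volume are frozen to `+1`, `⟨σ_x σ_y⟩ = 1`. [folklore] -/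
theorem isingTwoPoint_free_eq_one_of_notMem {V : Type*} [DecidableEq V] (G : SimpleGraph V)
    [G.LocallyFinite] (Λ : Finset V) (β h : ℝ) {x y : V} (hx : x ∉ Λ) (hy : y ∉ Λ) :
    isingTwoPoint G Λ β h .free x y = 1 := by
  rw [isingTwoPoint, isingExpect, integral_isingMeasure _ _ _ _ _ (measurable_spinPair x y)]
  have hsp : ∀ τ : Λ → ℤˣ, spinPair x y (glue Λ τ .free) = 1 := fun τ => by
    simp [spinPair, spinAt, glue_apply_of_notMem _ _ _ hx, glue_apply_of_notMem _ _ _ hy]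
  simp only [hsp, mul_one]
  exact div_self (isingPartitionFunction_pos G Λ β h .free).ne'

/-- Auxiliary lattice/real-analysis fact for the negative-side analysis of `IsingBoundaryRatio` (see the module docstring). [folklore] -/
theorem meshDomainFinset_of_nonpos (Ω : Set ℂ) {δ : ℝ} (hδ : δ ≤ 0) : meshDomainFinset Ω δ = ∅ := by
  unfold meshDomainFinset
  rw [dif_neg]
  exact fun h => absurd h.2 (not_lt.2 hδ)

/-- Non-positive mesh: the inline volume is `∅`, so `T Ω δ x y = 1` and the crux's ratio is
IDENTICALLY `1` on `δ ≤ 0` (invisible along `𝓝[>] 0`). [folklore] -/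
theorem T_of_nonpos (Ω : Set ℂ) {δ : ℝ} (hδ : δ ≤ 0) (x y : Site 2) : T Ω δ x y = 1 := by
  unfold T
  rw [meshDomainFinset_of_nonpos Ω hδ]
  exact isingTwoPoint_free_eq_one_of_notMem _ _ _ _ (Finset.notMem_empty x) (Finset.notMem_empty y)

/-- Auxiliary lattice/real-analysis fact for the negative-side analysis of `IsingBoundaryRatio` (see the module docstring). [folklore] -/
theorem ratio_of_nonpos (D D' : DobrushinDomain) (a b : ℝ → Site 2) {δ : ℝ} (hδ : δ ≤ 0) :
    ratio D D' a b δ = 1 := by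
  simp [ratio, T_of_nonpos _ hδ]

/-- STRENGTHENING REFUTED (modulo an off-diagonal datum): with the two-sided filter `𝓝 0` in place
of `𝓝[>] 0` the conclusion fails for every datum with `0 ≤ d ≠ 1`, because the ratio is `≡ 1` on
`δ ≤ 0`. (On the diagonal `d = 1` and the two-sided version happens to hold.) [folklore] -/
theorem not_tendsto_twoSided (D D' : DobrushinDomain) (a b : ℝ → Site 2) {d : ℝ} (hd0 : 0 ≤ d)
    (hd : d ≠ 1) : ¬ Tendsto (ratio D D' a b) (𝓝 0) (𝓝 (d ^ ((1 : ℝ) / 2))) := by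
  intro h
  have h1 : Tendsto (ratio D D' a b) (𝓝[≤] 0) (𝓝 1) := by
    refine (tendsto_const_nhds (x := (1 : ℝ))).congr' ?_
    filter_upwards [self_mem_nhdsWithin] with δ hδ
    exact (ratio_of_nonpos D D' a b hδ).symm
  have heq : d ^ ((1 : ℝ) / 2) = 1 := tendsto_nhds_unique (h.mono_left nhdsWithin_le_nhds) h1
  have : d = 1 := by
    have h2 := congrArg (fun t : ℝ => t ^ (2 : ℕ)) heq
    simp only [one_pow] at h2
    rwa [← Real.rpow_mul_natCast hd0, show (1 : ℝ) / 2 * (2 : ℕ) = 1 by norm_num, Real.rpow_one] at h2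
  exact hd this

/-! ## §3 Lattice facts at `δ > 0`: membership, positivity, GKS sandwich, nesting -/

/-- Auxiliary lattice/real-analysis fact for the negative-side analysis of `IsingBoundaryRatio` (see the module docstring). [folklore] -/
theorem mem_meshDomain_of_reachable_ne {Ω : Set ℂ} {δ : ℝ} {x y : Site 2}
    (h : (discreteDomainGraph Ω δ).Reachable x y) (hne : x ≠ y) : x ∈ meshDomain Ω δ := by
  obtain ⟨p⟩ := h
  cases p with
  | nil => exact absurd rfl hne
  | cons hadj _ => exact (discreteDomainGraph_adj_iff.1 hadj).2.1

/-- Auxiliary lattice/real-analysis fact for the negative-side analysis of `IsingBoundaryRatio` (see the module docstring). [folklore] -/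
theorem mem_meshDomainFinset_of_reachable_ne {Ω : Set ℂ} {δ : ℝ} (hΩ : Bornology.IsBounded Ω)
    (hδ : 0 < δ) {x y : Site 2} (h : (discreteDomainGraph Ω δ).Reachable x y) (hne : x ≠ y) :
    x ∈ meshDomainFinset Ω δ ∧ y ∈ meshDomainFinset Ω δ := by
  rw [← Finset.mem_coe, ← Finset.mem_coe, coe_meshDomainFinset hΩ hδ]
  exact ⟨mem_meshDomain_of_reachable_ne h hne, mem_meshDomain_of_reachable_ne h.symm hne.symm⟩

/-- PATH WITNESS for the high-temperature expansion: the edge set of a self-avoiding path from `x`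
to `y ≠ x` inside `Λ` has odd vertices exactly `{x, y}`, so it is a term of `g_Λ({x} ∆ {y})` and
`g_Λ({x} ∆ {y}) ≥ t^{|p|} > 0` for `t > 0`. [folklore] -/
theorem hteSum_pos_of_path {V : Type*} [DecidableEq V] (G : SimpleGraph V) [G.LocallyFinite]
    (Λ : Finset V) {t : ℝ} (ht : 0 < t) {x y : V} (hne : x ≠ y) (p : G.Walk x y) (hp : p.IsPath)
    (hΛ : ∀ v ∈ p.support, v ∈ Λ) : 0 < hteSum G Λ t ({x} ∆ {y}) := by
  set F : Finset (Sym2 V) := p.edges.toFinset with hF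
  have hFsub : F ⊆ edgesIn G Λ := fun e he => by
    rw [hF, List.mem_toFinset] at he
    rw [mem_edgesIn_iff]
    exact ⟨p.edges_subset_edgeSet he, fun v hv => hΛ v (SimpleGraph.Walk.mem_support_of_mem_edges he hv)⟩
  have hcount : ∀ v, (F.filter fun e => v ∈ e).card = p.edges.countP fun e => v ∈ e := fun v => by
    rw [List.countP_eq_length_filter, ← List.toFinset_card_of_nodup (hp.isTrail.edges_nodup.filter _),
      List.toFinset_filter, hF]
    congr 1
    ext e
    simp
  have hodd : oddVerts Λ F = {x} ∆ {y} := by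
    ext v
    rw [oddVerts, Finset.mem_filter, hcount, ← Nat.not_even_iff_odd, hp.isTrail.even_countP_edges_iff,
      Finset.mem_symmDiff, Finset.mem_singleton, Finset.mem_singleton]
    constructor
    · rintro ⟨-, h⟩
      by_cases hvx : v = x
      · exact Or.inl ⟨hvx, hvx ▸ hne⟩
      · have hvy : v = y := by
          by_contra hvy
          exact h fun _ => ⟨hvx, hvy⟩
        exact Or.inr ⟨hvy, hvy ▸ hne.symm⟩
    · rintro (⟨rfl, -⟩ | ⟨rfl, -⟩)
      · exact ⟨hΛ _ p.start_mem_support, fun h => (h hne).1 rfl⟩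
      · exact ⟨hΛ _ p.end_mem_support, fun h => (h hne).2 rfl⟩
  have hmem : F ∈ (edgesIn G Λ).powerset.filter fun F => oddVerts Λ F = {x} ∆ {y} :=
    Finset.mem_filter.2 ⟨Finset.mem_powerset.2 hFsub, hodd⟩
  unfold hteSum
  exact lt_of_lt_of_le (pow_pos ht _)
    (Finset.single_le_sum (f := fun F : Finset (Sym2 V) => t ^ F.card) (fun _ _ => pow_nonneg ht.le _) hmem)

/-- Auxiliary lattice/real-analysis fact for the negative-side analysis of `IsingBoundaryRatio` (see the module docstring). [folklore] -/
theorem tanh_criticalBetaTwo_pos : 0 < Real.tanh criticalBetaTwo := by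
  rw [DiluteLoopModel.tanh_criticalBetaTwo, sub_pos]
  exact Real.lt_sqrt_of_sq_lt (by norm_num)

/-- STRICT POSITIVITY: for `δ > 0` and bounded `Ω`, if `x` and `y` are joined in `Ω_δ` then
`0 < T Ω δ x y` (high-temperature expansion `⟨σ_xσ_y⟩ = g({x}∆{y})/g(∅)` + path witness). [folklore] -/
theorem T_pos_of_reachable {Ω : Set ℂ} {δ : ℝ} (hΩ : Bornology.IsBounded Ω) (hδ : 0 < δ)
    {x y : Site 2} (h : (discreteDomainGraph Ω δ).Reachable x y) : 0 < T Ω δ x y := by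
  by_cases hne : x = y
  · subst hne; simp
  obtain ⟨hx, hy⟩ := mem_meshDomainFinset_of_reachable_ne hΩ hδ h hne
  obtain ⟨p⟩ := h
  unfold T
  rw [isingTwoPoint_free_eq_hteSum_div _ _ _ hx hy]
  refine div_pos ?_ (hteSum_empty_pos _ _ _)
  refine hteSum_pos_of_path _ _ tanh_criticalBetaTwo_pos hne p.toPath p.toPath.2 fun v hv => ?_
  rw [← Finset.mem_coe, coe_meshDomainFinset hΩ hδ]
  have hx' : x ∈ meshDomain Ω δ := by
    rw [← coe_meshDomainFinset hΩ hδ]; exact hx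
  exact DiluteLoopModel.support_subset_meshDomain _ hx' v hv

/-- `|T| ≤ 1` always. [folklore] -/
theorem abs_T_le_one (Ω : Set ℂ) (δ : ℝ) (x y : Site 2) : |T Ω δ x y| ≤ 1 := by
  unfold T
  rw [isingTwoPoint, spinPair_eq_spinProduct_symmDiff, ← isingCorr]
  exact abs_isingCorr_le_one _ _ _ _ _ _

/-- Auxiliary lattice/real-analysis fact for the negative-side analysis of `IsingBoundaryRatio` (see the module docstring). [folklore] -/
theorem T_le_one (Ω : Set ℂ) (δ : ℝ) (x y : Site 2) : T Ω δ x y ≤ 1 :=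
  (le_abs_self _).trans (abs_T_le_one Ω δ x y)

end Summit.CriticalPhenomena.SAWScalingLimit.Theorems.IsingBoundaryRatio.Negative
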